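import Literature.Barriers.QuantumAdvantage.RandomOracleMethod
import Literature.Computability.Complexity.AlmostPProofs
import Literature.Computability.QuantumComplexity.SimUniformity
import HarnessLib

/-!
# Fortnow–Rogers 1999, Thm. 4.4, proved (`fortnowRogers1999_thm44_holds`) via Bennett–Gill's `ALMOST-P ⊆ BPP`

Sibling proof file of `RandomOracleMethod.lean` (D-0014: the fact
`Literature.Barriers.QuantumAdvantage.fortnowRogers1999_thm44` stays a `def`; this file proves
`fortnowRogers1999_thm44_holds`).

**The printed proof** (L. Fortnow, J. Rogers, *Complexity limitations on quantum computation*,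
JCSS 59 (1999), arXiv:cs/9811023, Thm. 4.4, p. 8): "Let `L` be in `BQP`, then for every oracle
`R`, `L` is in `BQP^R`. Thus by assumption `L` is in `P^R` for most oracles `R`. Bennett and Gill
[BeGi] show that every language with this property sits in `BPP`." (together with the standard
`BPP ⊆ BQP`, p. 2: "We know that `BPP ⊆ BQP`").

In the tree: `BQP ⊆ BQP^R` is `Literature.Computability.Cryptography.BQP_subset_BQPRel` (proved, `ClassBQP.lean`)
and `BPP ⊆ BQP` is the discharged fact `Literature.Computability.QuantumComplexity.BPP_subset_BQP_holds`
(`SimUniformity.lean`; Bernstein–Vazirani 1997, Thm. 8.3). Hence Thm. 4.4 reduces to the single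
remaining ingredient, Bennett–Gill's theorem `ALMOST-P ⊆ BPP` ("`L ∈ P^A` with probability `1`
over the random oracle `A` implies `L ∈ BPP`"; Bennett–Gill, SIAM J. Comput. 10 (1981) 96–113;
Book–Vollmer–Wagner, ICALP 1996, p. 410: "ALMOST-P = BPP"), which is vendored in
`Literature/Computability/Complexity/AlmostP.lean` (`Literature.Computability.Complexity.almostP_subset_BPP`)
and PROVED in `AlmostPProofs.lean` (`almostP_subset_BPP_holds`: countable pigeonhole over the
polynomial-time oracle machines, Lebesgue density on the random-oracle space
(`RandomOracleCylinders.lean`), the lazy-sampling identity (`LazySampling*.lean`) and the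
polynomial-time coin-flip simulator (`LazySamplingMachine.lean`)). The hypothesis is spelled out
here in exactly that form (`fortnowRogers1999_thm44_of_almostP_subset_BPP`) and discharged
(`fortnowRogers1999_thm44_holds`); the barrier `RandomOracleMethod` then holds granted only
Aaronson–Ambainis Thm. 7 (iii) (`randomOracleMethod_of_thm7iii`), and reading (a) is unconditional
(`not_ae_P_eq_BQP_of_summit_holds`).

## References

* L. Fortnow, J. Rogers, *Complexity limitations on quantum computation*, J. Comput. System
  Sci. 59 (1999) 240–252 (arXiv:cs/9811023), Thm. 4.4 and its proof (pp. 7–8)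
  [FortnowRogers1999JCSS].
* C. H. Bennett, J. Gill, *Relative to a random oracle `A`, `P^A ≠ NP^A ≠ co-NP^A` with
  probability 1*, SIAM J. Comput. 10 (1981) 96–113 [BennettGill1981].
* R. V. Book, H. Vollmer, K. W. Wagner, *Probabilistic type-2 operators and "almost"-classes*,
  ICALP 1996, LNCS 1099, p. 410 ("ALMOST-P = BPP").
* E. Bernstein, U. Vazirani, *Quantum complexity theory*, SIAM J. Comput. 26 (1997), Thm. 8.3
  (`BPP ⊆ BQP`), §8 (`BQP^A`).
-/

namespace Literature.Barriers.QuantumAdvantage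

open MeasureTheory _root_.Computability Literature.Computability.Complexity Literature.Computability.Cryptography Literature.Computability.QuantumComplexity

/-- **`BQP ⊆ ALMOST-BQP`-to-`ALMOST-P` step of Thm. 4.4**: if `P^A = BQP^A` with probability `1`
over the random oracle `A`, then every `L ∈ BQP` is in `P^A` with probability `1` ("for every
oracle `R`, `L` is in `BQP^R`. Thus by assumption `L` is in `P^R` for most oracles `R`").
[cite: FortnowRogers1999JCSS, Thm. 4.4 (proof, p. 8)] -/
theorem ae_mem_PRel_of_mem_BQP
    (hae : ∀ᵐ A ∂randomOracleMeasure,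
      PRel (Oracle.ofLanguage (A : Language Bool)) = BQPRel (A : Language Bool))
    {L : Language Bool} (hL : L ∈ BQP) :
    ∀ᵐ A ∂randomOracleMeasure, L ∈ PRel (Oracle.ofLanguage (A : Language Bool)) := by
  filter_upwards [hae] with A hA
  rw [hA]
  exact BQP_subset_BQPRel _ hL

/-- **Fortnow–Rogers Thm. 4.4 from Bennett–Gill's `ALMOST-P ⊆ BPP`.** Granted that every
language which is in `P^A` with probability `1` over the random oracle `A` lies in `BPP`
(Bennett–Gill 1981; the tree's named fact `Literature.CplxCore.almostP_subset_BPP`, spelled out), the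
printed statement follows: `BQP ⊆ BPP` by the previous lemma and Bennett–Gill, and
`BPP ⊆ BQP` unconditionally (`Literature.Computability.QuantumComplexity.BPP_subset_BQP_holds`).
[cite: FortnowRogers1999JCSS, Thm. 4.4 (proof, p. 8)] [cite: BennettGill1981] -/
theorem fortnowRogers1999_thm44_of_almostP_subset_BPP
    (hBG : ∀ L : Language Bool,
      (∀ᵐ A ∂randomOracleMeasure, L ∈ PRel (Oracle.ofLanguage (A : Language Bool))) → L ∈ BPP) :
    fortnowRogers1999_thm44 := by
  intro hae
  refine Set.Subset.antisymm (fun L hL => hBG L (ae_mem_PRel_of_mem_BQP hae hL)) ?_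
  exact BPP_subset_BQP_holds

/-- Hence, granted Bennett–Gill, the no-go reading **(a)** of the barrier entry is unconditional:
under the summit (`∃ L ∈ BQP, L ∉ BPP`), `P = BQP` fails relative to a random oracle with
probability `1`. [cite: FortnowRogers1999JCSS, Thm. 4.4] [cite: BennettGill1981] -/
theorem not_ae_P_eq_BQP_of_summit_of_almostP_subset_BPP
    (hBG : ∀ L : Language Bool,
      (∀ᵐ A ∂randomOracleMeasure, L ∈ PRel (Oracle.ofLanguage (A : Language Bool))) → L ∈ BPP)
    (hsummit : ∃ L : Language Bool, L ∈ BQP ∧ L ∉ BPP) :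
    ¬ ∀ᵐ A ∂randomOracleMeasure,
      PRel (Oracle.ofLanguage (A : Language Bool)) = BQPRel (A : Language Bool) :=
  not_ae_P_eq_BQP_of_summit (fortnowRogers1999_thm44_of_almostP_subset_BPP hBG) hsummit

/-! ### The discharge -/

/-- **Fortnow–Rogers Thm. 4.4 from the named fact `almostP_subset_BPP`** (Bennett–Gill's
`ALMOST-P ⊆ BPP`, `AlmostP.lean`). [cite: FortnowRogers1999JCSS, Thm. 4.4 (proof, p. 8)] -/
theorem fortnowRogers1999_thm44_of_almostP (h : Literature.Computability.Complexity.almostP_subset_BPP) :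
    fortnowRogers1999_thm44 :=
  fortnowRogers1999_thm44_of_almostP_subset_BPP fun _ hL => h hL

/-- **Fortnow–Rogers 1999, Thm. 4.4** ("If `P = BQP` relative to random oracle then `BQP = BPP`
(unrelativized)"), proved: Bennett–Gill's `ALMOST-P ⊆ BPP` is the tree theorem
`Literature.Computability.Complexity.almostP_subset_BPP_holds`. Discharge of the named fact
`fortnowRogers1999_thm44`. [cite: FortnowRogers1999JCSS, Thm. 4.4 (proof, p. 8)] -/
theorem fortnowRogers1999_thm44_holds : fortnowRogers1999_thm44 :=
  fortnowRogers1999_thm44_of_almostP Literature.Computability.Complexity.almostP_subset_BPP_holds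

/-- **The barrier `RandomOracleMethod`, granted Aaronson–Ambainis Thm. 7 (iii)** (its first
conjunct, Fortnow–Rogers Thm. 4.4, being proved). [cite: FortnowRogers1999JCSS, Thm. 4.4] [cite: AaronsonAmbainis2014, Thm. 7 (iii)] -/
theorem randomOracleMethod_of_thm7iii (h7 : aaronsonAmbainis2014_thm7iii) : RandomOracleMethod :=
  ⟨fortnowRogers1999_thm44_holds, h7⟩

/-- Reading **(a)** of the barrier, unconditionally: under the summit (`∃ L ∈ BQP, L ∉ BPP`),
`P = BQP` does not hold relative to a random oracle with probability `1`. [cite: FortnowRogers1999JCSS, Thm. 4.4] -/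
theorem not_ae_P_eq_BQP_of_summit_holds (hsummit : ∃ L : Language Bool, L ∈ BQP ∧ L ∉ BPP) :
    ¬ ∀ᵐ A ∂randomOracleMeasure,
      PRel (Oracle.ofLanguage (A : Language Bool)) = BQPRel (A : Language Bool) :=
  not_ae_P_eq_BQP_of_summit fortnowRogers1999_thm44_holds hsummit

/-- Reading **(a′)**, unconditionally: a probability-`1` random-oracle collapse `P^A = BQP^A`
settles the summit negatively (`BQP ⊆ BPP`). [cite: FortnowRogers1999JCSS, Thm. 4.4] -/
theorem BQP_subset_BPP_of_ae_collapse_holds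
    (hae : ∀ᵐ A ∂randomOracleMeasure,
      PRel (Oracle.ofLanguage (A : Language Bool)) = BQPRel (A : Language Bool)) :
    BQP ⊆ BPP :=
  BQP_subset_BPP_of_ae_collapse fortnowRogers1999_thm44_holds hae

end Literature.Barriers.QuantumAdvantage
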